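import Summits.QuantumFields.YangMills.Theorems.UnitScaleTiltProp7CornerCombInCellLetters
import Literature.MathematicalPhysics.QuantumFieldTheory.Balaban1983to89.B7Eq47AveragedBondVsStraight
import HarnessLib

/-!
# Route `UnitScaleTilt`, crux K1 «MinimiserStabilityRegPr» (stmt-QuantumFields-19200), route-R E′ (A′)-on-Σ, P-A2 (β), row «(n3)-comb» —
# (O2) GROUNDWORK, file F-6c-2a: TWO-LEVEL TRANSPORT LETTERS
# («the level-(i+1) tree transport, read one level down, IS the level-i tree transport of the dilated vector, bond by bond — up to the bond closeness `δ`»)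

«(O2) groundwork — not consumed by any displayed row before the freeze lifts» (★★OWNER `ym3-torus-plan` g29∕g30 RULINGS №20 (2), №22; «(II) GO» 06:26∕06:31Z;
PENS ROUND 3 08:01:48Z, organisation «β»).  Cell `ym3-torus`, D-0154 (3c) R3 twin-width seat `ym-routeR-w1` (gen 9).  THEOREMS ONLY (0 `def`, 0 `sorry`);
`--supports stmt-QuantumFields-19200 --as helper`, count-neutral.  YM₃ on T³ is a ladder rung (R3), not the Clay problem; nothing here claims `hMcomb`, `hMcomb₂`, (β),
`hPA2`, `hcoS`, the stub, the crux, d = 4 or the mass gap.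

THE POINT.  The letters of the dressed one-scale row (sequel F-6c-2b `…CornerCombDressedStepMean`): a level-`i` background `V` (U1-valued) and a next background `V′` every bond of
which is `δ`-close to the straight `L`-segment holonomy of `V` (`hbs`; at `V′ = rescale L (bavg L V)` = lit `avgIter`'s successor this is lit ✓`B7Eq47AveragedBondVsStraight.
norm_bavg_sub_straight_le` with `δ = 4α`, §3).
* §1 (any normed ring, `‖1‖ = 1`): `norm_mul_sub_mul_le_of_norm_le_one` (products of contractions), ★`norm_hol_seg_sub_hol_seg_mul_le` (`‖V′([y, y+m e_ν]) − V([Ly, Ly+Lm e_ν])‖ ≤ m·δ`),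
  ★★`norm_hol_tw_sub_le` ∕ ★★`norm_hol_treeWord_sub_le` (`‖V′(Γ_{y,y+s′}) − V(Γ_{Ly,Ly+Ls′})‖ ≤ |Γ_{y,y+s′}|·δ`: lit `tw` induction, `hol_append`, `hol_seg_mul_add`).
* §2 (bookkeeping on `ℤᵈ`): `dilateIdx_injective` ∕ `boxVec_dilateIdx` (the index map `(s′, r) ↦ L s′ + r + min(t, L−1)δ_μ` of the shifted big cubes into a cube `Fin d → Fin (n+1)`,
  `L² + L ≤ n+1`: injective, reads `L•s′ + r + t•e_μ`), `length_treeWord_smul_boxVec_le` (`|Γ_{0,L•s′}| ≤ d·L²`).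
* §3 `norm_rescale_bavg_sub_hol_seg_le` — the `hbs` discharge (`δ = 4α` under the loop window `α ≤ 1∕8`).
Constants: none beyond the displayed; nothing reads a level, `k`, the torus, `K`, the member ((g1)(g2)).  HONEST SCOPE: elementary transport bookkeeping over lit rows.

References: T. Bałaban, CMP **98** (1985) 17–51 [Balaban1985Averaging] ((42)–(47) pp.23–25, (65) p.29); CMP **96** (1984) 223–250 [Balaban1984PropagatorsII] ((1.9) p.226).
-/

set_option autoImplicit false

noncomputable section

open scoped BigOperators Matrix.Norms.L2Operator

namespace Summit.QuantumFields.YangMills.Theorems.Prop7CornerCombTwoLevelTransport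

open Finset
open Literature.MathematicalPhysics.QuantumFieldTheory.Balaban1983to89
open B7Prop1Explicit (Site Letter e boxVec seg treeWord hol disp l1 U1 mem_U1 hol_mem e_apply hol_append hol_nil hol_seg_natCast_succ
  seg_natCast disp_seg length_treeWord length_seg Wcx bavg)
open B8Lemma1NonAbelian (tw tw_cons tw_nil treeWord_eq_tw)
open B7Eq47AveragedBondVsStraight (hol_seg_mul_add norm_bavg_sub_straight_le)

/-! ## §1 Two-level transport: the next-level tree word against the dilated tree word one level down -/

section Transport

variable {d : ℕ} {𝔸 : Type*} [NormedRing 𝔸] [NormOneClass 𝔸]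

omit [NormOneClass 𝔸] in
/-- Products of contractions: `‖AB − A′B′‖ ≤ ‖A − A′‖ + ‖B − B′‖` when `‖B‖ ≤ 1` and `‖A′‖ ≤ 1`. [folklore] -/
theorem norm_mul_sub_mul_le_of_norm_le_one {A A' B B' : 𝔸} (hB : ‖B‖ ≤ 1) (hA' : ‖A'‖ ≤ 1) :
    ‖A * B - A' * B'‖ ≤ ‖A - A'‖ + ‖B - B'‖ := by
  have h : A * B - A' * B' = (A - A') * B + A' * (B - B') := by noncomm_ring
  rw [h]
  calc _ ≤ ‖(A - A') * B‖ + ‖A' * (B - B')‖ := norm_add_le _ _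
    _ ≤ ‖A - A'‖ * ‖B‖ + ‖A'‖ * ‖B - B'‖ := add_le_add (norm_mul_le _ _) (norm_mul_le _ _)
    _ ≤ ‖A - A'‖ * 1 + 1 * ‖B - B'‖ :=
        add_le_add (mul_le_mul_of_nonneg_left hB (norm_nonneg _)) (mul_le_mul_of_nonneg_right hA' (norm_nonneg _))
    _ = _ := by ring

variable (L : ℕ) {V V' : Site d → Fin d → 𝔸ˣ} (hV : ∀ x κ, V x κ ∈ U1 𝔸) (hV' : ∀ x κ, V' x κ ∈ U1 𝔸) {δ : ℝ}
  (hbs : ∀ (z : Site d) (ν : Fin d), ‖((V' z ν : 𝔸ˣ) : 𝔸) - ((hol V ((L : ℤ) • z) (seg ν (L : ℤ)) : 𝔸ˣ) : 𝔸)‖ ≤ δ)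
include hV hV' hbs

/-- ★ **SEGMENTS**: `‖V′([y, y + m e_ν]) − V([L•y, L•y + L·m e_ν])‖ ≤ m·δ` — each of the `m` bonds of `V′` is `δ`-close to the corresponding straight `L`-segment of `V`,
and holonomies of `U1` fields are contractions. [cite: Balaban1985Averaging, (65) p.29, (43) p.24] -/
theorem norm_hol_seg_sub_hol_seg_mul_le (y : Site d) (ν : Fin d) :
    ∀ m : ℕ, ‖((hol V' y (seg ν (m : ℤ)) : 𝔸ˣ) : 𝔸) - ((hol V ((L : ℤ) • y) (seg ν ((L * m : ℕ) : ℤ)) : 𝔸ˣ) : 𝔸)‖ ≤ m * δ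
  | 0 => by simp
  | m + 1 => by
    have ih := norm_hol_seg_sub_hol_seg_mul_le y ν m
    have h1 : hol V' y (seg ν ((m + 1 : ℕ) : ℤ)) = hol V' y (seg ν (m : ℤ)) * V' (y + (m : ℤ) • e ν) ν := by
      rw [show ((m + 1 : ℕ) : ℤ) = (m : ℤ) + 1 by push_cast; rfl, hol_seg_natCast_succ]
    have h2 : hol V ((L : ℤ) • y) (seg ν ((L * (m + 1) : ℕ) : ℤ))
        = hol V ((L : ℤ) • y) (seg ν ((L * m : ℕ) : ℤ)) * hol V ((L : ℤ) • y + ((L * m : ℕ) : ℤ) • e ν) (seg ν (L : ℤ)) := by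
      rw [Nat.mul_succ, hol_seg_mul_add]
    have hpt : (L : ℤ) • (y + (m : ℤ) • e ν) = (L : ℤ) • y + ((L * m : ℕ) : ℤ) • e ν := by
      rw [smul_add, smul_smul]; push_cast; rfl
    have h3 := hbs (y + (m : ℤ) • e ν) ν
    rw [hpt] at h3
    rw [h1, h2, Units.val_mul, Units.val_mul]
    calc _ ≤ ‖((hol V' y (seg ν (m : ℤ)) : 𝔸ˣ) : 𝔸) - ((hol V ((L : ℤ) • y) (seg ν ((L * m : ℕ) : ℤ)) : 𝔸ˣ) : 𝔸)‖
          + ‖((V' (y + (m : ℤ) • e ν) ν : 𝔸ˣ) : 𝔸) - ((hol V ((L : ℤ) • y + ((L * m : ℕ) : ℤ) • e ν) (seg ν (L : ℤ)) : 𝔸ˣ) : 𝔸)‖ :=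
          norm_mul_sub_mul_le_of_norm_le_one (mem_U1.1 (hV' _ _)).1 (mem_U1.1 (hol_mem hV _ _)).1
      _ ≤ m * δ + δ := add_le_add ih h3
      _ = ((m + 1 : ℕ) : ℝ) * δ := by push_cast; ring

/-- ★★ **TREE WORDS, BOND BY BOND**: for `v ≥ 0` coordinatewise and any list of directions `ks`, `‖V′(tw ks v from y) − V(tw ks (L•v) from L•y)‖ ≤ |tw ks v|·δ` — the level-(i+1) tree
word read one level down IS the tree word of the dilated vector (same order of directions, each letter dilated to an `L`-segment). [cite: Balaban1985Averaging, (43) p.24, (65) p.29] -/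
theorem norm_hol_tw_sub_le :
    ∀ (ks : List (Fin d)) (v : Site d), (∀ κ, 0 ≤ v κ) → ∀ y : Site d,
      ‖((hol V' y (tw ks v) : 𝔸ˣ) : 𝔸) - ((hol V ((L : ℤ) • y) (tw ks ((L : ℤ) • v)) : 𝔸ˣ) : 𝔸)‖ ≤ (tw ks v).length * δ
  | [], v, _, y => by simp
  | κ :: ks, v, hv, y => by
    obtain ⟨m, hm⟩ := Int.eq_ofNat_of_zero_le (hv κ)
    have ih := norm_hol_tw_sub_le ks v hv (y + v κ • e κ)
    have hseg := norm_hol_seg_sub_hol_seg_mul_le L hV hV' hbs y κ m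
    have hLv : ((L : ℤ) • v) κ = ((L * m : ℕ) : ℤ) := by rw [Pi.smul_apply, smul_eq_mul, hm]; push_cast; ring
    have hpt : (L : ℤ) • (y + v κ • e κ) = (L : ℤ) • y + ((L : ℤ) • v) κ • e κ := by
      rw [smul_add, hLv, hm, smul_smul]; push_cast; rfl
    rw [tw_cons, tw_cons, hol_append, hol_append, disp_seg, disp_seg, Units.val_mul, Units.val_mul, ← hpt, hLv, hm,
      List.length_append, length_seg, Int.natAbs_natCast, Nat.cast_add, add_mul]
    calc _ ≤ ‖((hol V' y (seg κ (m : ℤ)) : 𝔸ˣ) : 𝔸) - ((hol V ((L : ℤ) • y) (seg κ ((L * m : ℕ) : ℤ)) : 𝔸ˣ) : 𝔸)‖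
          + ‖((hol V' (y + (m : ℤ) • e κ) (tw ks v) : 𝔸ˣ) : 𝔸) - ((hol V ((L : ℤ) • (y + (m : ℤ) • e κ)) (tw ks ((L : ℤ) • v)) : 𝔸ˣ) : 𝔸)‖ :=
          norm_mul_sub_mul_le_of_norm_le_one (mem_U1.1 (hol_mem hV' _ _)).1 (mem_U1.1 (hol_mem hV _ _)).1
      _ ≤ m * δ + (tw ks v).length * δ := add_le_add hseg (by rw [hm] at ih; exact ih)

/-- ★★ **THE NEXT-LEVEL TREE TRANSPORT AGAINST THE DILATED TREE TRANSPORT**: `‖V′(Γ_{y, y+s′}) − V(Γ_{L•y, L•y + L•s′})‖ ≤ |Γ_{y,y+s′}|·δ`.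
[cite: Balaban1985Averaging, (43) p.24, (65) p.29] -/
theorem norm_hol_treeWord_sub_le {M : ℕ} (y : Site d) (s' : Fin d → Fin M) :
    ‖((hol V' y (treeWord (boxVec M s')) : 𝔸ˣ) : 𝔸) - ((hol V ((L : ℤ) • y) (treeWord ((L : ℤ) • boxVec M s')) : 𝔸ˣ) : 𝔸)‖
      ≤ (treeWord (boxVec M s')).length * δ := by
  rw [treeWord_eq_tw, treeWord_eq_tw]
  exact norm_hol_tw_sub_le L hV hV' hbs _ _ (fun κ => by simp [boxVec]) y

end Transport


/-! ## §2 Index and length bookkeeping for the dressed row -/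

section Bookkeeping

variable {d : ℕ}

/-- **THE INDEX MAP OF THE `L` SHIFTED BIG CUBES** into the cube `Fin d → Fin (n+1)` (`L² + L ≤ n + 1`): `(s′, r) ↦ L s′ + r + min(t, L−1)·δ_μ` is injective
(Euclidean division coordinatewise). [folklore] -/
theorem dilateIdx_injective (L n : ℕ) (hL : 0 < L) (hn : L * L + L ≤ n + 1) (μ : Fin d) (t : ℕ) :
    Function.Injective (fun (p : (Fin d → Fin L) × (Fin d → Fin L)) (i : Fin d) =>
      (⟨L * (p.1 i : ℕ) + (p.2 i : ℕ) + (if i = μ then min t (L - 1) else 0), by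
        have h1 : L * ((p.1 i : ℕ) + 1) ≤ L * L := Nat.mul_le_mul_left L (p.1 i).isLt
        have h2 := (p.2 i).isLt
        have h3 : min t (L - 1) ≤ L - 1 := min_le_right _ _
        rw [Nat.mul_succ] at h1
        split_ifs <;> omega⟩ : Fin (n + 1))) := by
  intro p p' hpp'
  have hc : ∀ i, L * (p.1 i : ℕ) + (p.2 i : ℕ) = L * (p'.1 i : ℕ) + (p'.2 i : ℕ) := fun i => by
    have hi := congrArg (fun f : Fin d → Fin (n + 1) => ((f i : Fin (n + 1)) : ℕ)) hpp'
    dsimp only at hi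
    omega
  have h1 : p.1 = p'.1 := by
    funext i
    have := congrArg (· / L) (hc i)
    rw [Nat.mul_add_div hL, Nat.mul_add_div hL, Nat.div_eq_of_lt (p.2 i).isLt, Nat.div_eq_of_lt (p'.2 i).isLt] at this
    exact Fin.ext (by simpa using this)
  have h2 : p.2 = p'.2 := by
    funext i
    have := congrArg (· % L) (hc i)
    rw [Nat.mul_add_mod, Nat.mul_add_mod, Nat.mod_eq_of_lt (p.2 i).isLt, Nat.mod_eq_of_lt (p'.2 i).isLt] at this
    exact Fin.ext this
  exact Prod.ext h1 h2

/-- The index map reads the lattice point `L•s′ + r + t•e_μ` (`t < L`). [folklore] -/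
theorem boxVec_dilateIdx (L n : ℕ) (hn : L * L + L ≤ n + 1) (μ : Fin d) {t : ℕ} (ht : t < L) (p : (Fin d → Fin L) × (Fin d → Fin L)) :
    boxVec (n + 1) (fun i => (⟨L * (p.1 i : ℕ) + (p.2 i : ℕ) + (if i = μ then min t (L - 1) else 0), by
        have h1 : L * ((p.1 i : ℕ) + 1) ≤ L * L := Nat.mul_le_mul_left L (p.1 i).isLt
        have h2 := (p.2 i).isLt
        have h3 : min t (L - 1) ≤ L - 1 := min_le_right _ _
        rw [Nat.mul_succ] at h1
        split_ifs <;> omega⟩ : Fin (n + 1)))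
      = (L : ℤ) • boxVec L p.1 + boxVec L p.2 + (t : ℤ) • e μ := by
  have hmin : min t (L - 1) = t := min_eq_left (by omega)
  funext i
  simp only [boxVec, Pi.add_apply, Pi.smul_apply, e_apply, smul_eq_mul, hmin]
  split_ifs <;> push_cast <;> ring

/-- `|Γ_{0, L•s′}| ≤ d·L²` for `s′ ∈ [0,L)ᵈ` (the dilated corner vector). [folklore] -/
theorem length_treeWord_smul_boxVec_le (L : ℕ) (s' : Fin d → Fin L) :
    ((treeWord ((L : ℤ) • boxVec L s')).length : ℝ) ≤ d * (L * L) := by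
  rw [length_treeWord]
  have h : ∀ i, (((((L : ℤ) • boxVec L s') i).natAbs : ℕ) : ℝ) ≤ L * L := fun i => by
    simp only [Pi.smul_apply, boxVec, smul_eq_mul]
    rw [show (L : ℤ) * ((s' i : ℕ) : ℤ) = ((L * (s' i : ℕ) : ℕ) : ℤ) by push_cast; ring, Int.natAbs_natCast]
    have := (s' i).isLt
    have h2 : L * (s' i : ℕ) ≤ L * L := Nat.mul_le_mul_left L this.le
    exact_mod_cast h2
  unfold l1
  push_cast
  calc ∑ i : Fin d, (((((L : ℤ) • boxVec L s') i).natAbs : ℕ) : ℝ) ≤ ∑ _i : Fin d, ((L : ℝ) * L) := Finset.sum_le_sum fun i _ => h i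
    _ = d * (L * L) := by rw [Finset.sum_const, Finset.card_univ, Fintype.card_fin, nsmul_eq_mul]

end Bookkeeping

/-! ## §3 The `hbs` discharge at `V′ = rescale L (bavg L V)` -/

section Discharge

variable {d : ℕ} {𝔸 : Type*} [NormedRing 𝔸] [NormOneClass 𝔸] [NormedAlgebra ℂ 𝔸] [CompleteSpace 𝔸]

/-- **`hbs` AT THE AVERAGED BACKGROUND**: with the loop window `‖W_{c,x} − 1‖ ≤ α ≤ 1∕8` at every base point, the next-level bond `Ū(z,ν) = bavg L V (L•z) ν` is `4α`-close
to the straight `L`-segment holonomy `V([L•z, L•z + L e_ν])` (lit ✓`norm_bavg_sub_straight_le`, (47) p. 25). [cite: Balaban1985Averaging, (42)–(47) pp.23–25] -/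
theorem norm_rescale_bavg_sub_hol_seg_le (L : ℕ) [NeZero L] {V : Site d → Fin d → 𝔸ˣ} (hV : ∀ x κ, V x κ ∈ U1 𝔸) {α : ℝ}
    (hα : ∀ (q : Site d) (κ : Fin d) (r : Fin d → Fin L), ‖((Wcx L V q κ (boxVec L r) : 𝔸ˣ) : 𝔸) - 1‖ ≤ α) (hα8 : α ≤ 1 / 8)
    (z : Site d) (ν : Fin d) :
    ‖((bavg L V ((L : ℤ) • z) ν : 𝔸ˣ) : 𝔸) - ((hol V ((L : ℤ) • z) (seg ν (L : ℤ)) : 𝔸ˣ) : 𝔸)‖ ≤ 4 * α :=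
  norm_bavg_sub_straight_le L hV ((L : ℤ) • z) ν (hα _ ν) hα8

end Discharge

end Summit.QuantumFields.YangMills.Theorems.Prop7CornerCombTwoLevelTransport
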